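import Summits.MatrixMultiplication.MatrixMultiplication.Theorems.ObstructionDescentBlockRestriction
import Summits.MatrixMultiplication.MatrixMultiplication.Theorems.ObstructionDescentUnitParity

set_option linter.dupNamespace false

/-!
# Propagated parity: odd levels die on twin-block points (decomp-mm · lens 3 · gen 14, part D)

Route `route-MatrixMultiplication-ObstructionDescent`, support for the aside `InvariantSaturation` (item
`stmt-MatrixMultiplication-32282`); continues `ObstructionDescentBlockRestriction` (law H13) and
`ObstructionDescentLeviWeylLaw` (law H12).

THE LAW («(PP)», the census's propagated-parity rule of NODE-g11, here a theorem).  ABSTRACT FORM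
(`evalT_eq_zero_of_propagatedParity`): let `f` be a `((k^N))³`-weight vector of degree `kN` with `k` ODD, `σ` an odd
permutation of the indices moving only corner indices, and `u` a block-diagonal point for the last block `B` (size
`N₂ ≤ N`) such that `σ·u` is again block-diagonal and the HYBRID point `mixT N₂ u (σ·u)` (= `u` off the cube `B³`,
`σ·u` on it) is FIXED by `σ`.  If the weight-vector space of the block type `((k^{N₂}))³`, degree `k N₂`, is at most
one-dimensional (every member a multiple of one `g`), then `f(u) = 0`.  CONCRETE FORM (`evalT_eq_zero_of_twinBlocks`,
`not_mem_pointLevels_of_twinBlocks`): `u = x ⊞ a ⊞ b ∈ twinDiag m N₂` (entries supported on the three cubes of the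
partition rest ⊔ B₁ ⊔ B₂ of the indices into `[0, m-2N₂)`, `[m-2N₂, m-N₂)`, `[m-N₂, m)`), `N₂` ODD, `2N₂ ≤ N ≤ m`,
`σ = twinSwap N₂` the swap `B₁ ↔ B₂` (`sign σ = (-1)^{N₂}`, `sign_twinSwap`), whose hybrid point is the symmetric
`x ⊞ a ⊞ a`: then `f(u) = 0` and `k ∉ E′_N(u)` at EVERY such `u`, symmetric or not — e.g. the level-3 generator of `5³`
dies on all `(3,1,1)`-block points and every level-3 vector of `9³` on all `(3,3,3)`-block points, given that the
block spaces (`1³` in degree 3, `3³` in degree 9) are lines.  Twin blocks elsewhere in the corner are moved to the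
last two positions by a corner relabelling (`pointLevels_actTensor_permMatrix`).

PROOF (four evaluations, no representation theory).  By H13 (`restrictB_mem_hwvSpace`) the restriction of `f` to
the cube at `u` is a block weight vector, hence `c_u • g`; likewise at `v := σ·u` it is `c_v • g`.  Evaluating,
`f(u) = c_u g(u)`, `f(mixT u v) = c_u g(v)`, `f(v) = c_v g(v)`, so `f(u) f(v) = c_v g(u) · f(mixT u v)`, and
`f(mixT u v) = 0` by the odd-symmetry vanishing (H12 (C), `evalT_eq_zero_of_oddSymmetry`) at the `σ`-fixed hybrid
point.  Finally `f(v) = -f(u)` (H12 (B′): an odd corner permutation acts by `sign^k = -1` in each of the three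
slots), so `f(u)² = 0`.  The twin swap is realised as `Equiv.Perm.extendDomain` of `N₂` disjoint transpositions
(`Equiv.prodCongrRight` of `Equiv.swap false true` on `Fin N₂ × Bool`), which gives its sign for free.
[cite: BurgisserIkenmeyer2011, §3.1–3.2] (weight vectors as Borel eigenvectors), [cite: BurgisserIkenmeyer2017, §5 (5.2)]
(the level sets `E′`).
-/

open scoped BigOperators
open Finset

namespace Summit.MatrixMultiplication.MatrixMultiplication.Theorems.ObstructionCalculus

open Literature.Computability.AlgebraicComplexity (actTensor actTensor_actTensor actTensor_permMatrix_apply)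

section PropagatedParity

variable {m : ℕ}

/-- Evaluation of a scalar multiple. [bookkeeping] -/
theorem evalT_smul (y : Tensor ℂ m) (c : ℂ) (g : MvPolynomial (Idx m) ℂ) : evalT y (c • g) = c * evalT y g := by
  rw [map_smul, smul_eq_mul]

/-- An odd corner permutation NEGATES an odd-level weight vector: `f(σ·x) = -f(x)`. [this node] -/
theorem evalT_actTensor_permMatrix_of_odd {N k d : ℕ} (hk : Odd k) {f : MvPolynomial (Idx m) ℂ}
    (hf : f ∈ hwvSpace (rectType m N k) d) (σ : Equiv.Perm (Fin m)) (hσ : ∀ a, σ a ≠ a → m ≤ (a : ℕ) + N)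
    (hsign : Equiv.Perm.sign σ = -1) (x : Tensor ℂ m) :
    evalT (actTensor (σ.permMatrix ℂ) (σ.permMatrix ℂ) (σ.permMatrix ℂ) x) f = -evalT x f := by
  have hσ' : ∀ s : Fin 3, ∀ a, σ a ≠ a → rectType m N k s a = k := fun s a ha => by
    simp only [rectType, if_pos (hσ a ha)]
  have h3 : actTensor (σ.permMatrix ℂ) (σ.permMatrix ℂ) (σ.permMatrix ℂ) x =
      slotAct 0 (σ.permMatrix ℂ) (slotAct 1 (σ.permMatrix ℂ) (slotAct 2 (σ.permMatrix ℂ) x)) := by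
    simp only [slotAct_zero, slotAct_one, slotAct_two, actTensor_actTensor, Matrix.mul_one, Matrix.one_mul]
  rw [h3, evalT_slotAct_permMatrix hf 0 σ (hσ' 0), evalT_slotAct_permMatrix hf 1 σ (hσ' 1),
    evalT_slotAct_permMatrix hf 2 σ (hσ' 2), hsign]
  push_cast
  rw [hk.neg_one_pow]
  ring

/-- **(PP) core — propagated parity.**  See the module docstring: `k` odd, `σ` an odd corner permutation, `u` and
`σ·u` block-diagonal for the last block of size `N₂ ≤ N`, the hybrid point `mixT N₂ u (σ·u)` fixed by `σ`, and the
block weight-vector space of type `((k^{N₂}))³`, degree `k N₂`, spanned by one `g` ⟹ `f(u) = 0`. [this node] -/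
theorem evalT_eq_zero_of_propagatedParity {N N₂ k : ℕ} (hN : N₂ ≤ N) (hN₂m : N₂ ≤ m) (hk : Odd k)
    {f : MvPolynomial (Idx m) ℂ} (hf : f ∈ hwvSpace (rectType m N k) (k * N))
    {g : MvPolynomial (Idx m) ℂ} (hg : ∀ f' ∈ hwvSpace (rectType m N₂ k) (k * N₂), ∃ c : ℂ, f' = c • g)
    (σ : Equiv.Perm (Fin m)) (hσ : ∀ a, σ a ≠ a → m ≤ (a : ℕ) + N) (hsign : Equiv.Perm.sign σ = -1)
    {u : Tensor ℂ m} (hu : u ∈ blockDiag m N₂)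
    (hv : actTensor (σ.permMatrix ℂ) (σ.permMatrix ℂ) (σ.permMatrix ℂ) u ∈ blockDiag m N₂)
    (hfix : actTensor (σ.permMatrix ℂ) (σ.permMatrix ℂ) (σ.permMatrix ℂ)
        (mixT N₂ u (actTensor (σ.permMatrix ℂ) (σ.permMatrix ℂ) (σ.permMatrix ℂ) u)) =
      mixT N₂ u (actTensor (σ.permMatrix ℂ) (σ.permMatrix ℂ) (σ.permMatrix ℂ) u)) :
    evalT u f = 0 := by
  set v := actTensor (σ.permMatrix ℂ) (σ.permMatrix ℂ) (σ.permMatrix ℂ) u with hv_def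
  obtain ⟨cu, hcu⟩ := hg _ (restrictB_mem_hwvSpace hN hN₂m hu hf)
  obtain ⟨cv, hcv⟩ := hg _ (restrictB_mem_hwvSpace hN hN₂m hv hf)
  have e₁ : evalT u f = cu * evalT u g := by
    conv_lhs => rw [← mixT_self N₂ u]
    rw [← evalT_restrictB, hcu, evalT_smul]
  have e₂ : evalT (mixT N₂ u v) f = cu * evalT v g := by
    rw [← evalT_restrictB, hcu, evalT_smul]
  have e₃ : evalT v f = cv * evalT v g := by
    conv_lhs => rw [← mixT_self N₂ v]
    rw [← evalT_restrictB, hcv, evalT_smul]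
  have e₀ : evalT (mixT N₂ u v) f = 0 := evalT_eq_zero_of_oddSymmetry hk hf σ hσ hsign hfix
  have e₄ : evalT v f = -evalT u f := evalT_actTensor_permMatrix_of_odd hk hf σ hσ hsign u
  have key : evalT u f * evalT v f = cv * evalT u g * evalT (mixT N₂ u v) f := by
    rw [e₁, e₂, e₃]; ring
  rw [e₀, mul_zero, e₄, mul_neg, neg_eq_zero] at key
  exact mul_self_eq_zero.1 key

/-- Hence an odd level `k` with a one-dimensional block weight-vector space is NOT a level of such a point.
[this node] -/
theorem not_mem_pointLevels_of_propagatedParity {N N₂ k : ℕ} (hN : N₂ ≤ N) (hN₂m : N₂ ≤ m) (hk : Odd k)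
    {g : MvPolynomial (Idx m) ℂ} (hg : ∀ f' ∈ hwvSpace (rectType m N₂ k) (k * N₂), ∃ c : ℂ, f' = c • g)
    (σ : Equiv.Perm (Fin m)) (hσ : ∀ a, σ a ≠ a → m ≤ (a : ℕ) + N) (hsign : Equiv.Perm.sign σ = -1)
    {u : Tensor ℂ m} (hu : u ∈ blockDiag m N₂)
    (hv : actTensor (σ.permMatrix ℂ) (σ.permMatrix ℂ) (σ.permMatrix ℂ) u ∈ blockDiag m N₂)
    (hfix : actTensor (σ.permMatrix ℂ) (σ.permMatrix ℂ) (σ.permMatrix ℂ)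
        (mixT N₂ u (actTensor (σ.permMatrix ℂ) (σ.permMatrix ℂ) (σ.permMatrix ℂ) u)) =
      mixT N₂ u (actTensor (σ.permMatrix ℂ) (σ.permMatrix ℂ) (σ.permMatrix ℂ) u)) :
    k ∉ pointLevels N u := by
  rintro ⟨f, hf, hne⟩
  exact hne (evalT_eq_zero_of_propagatedParity hN hN₂m hk hf hg σ hσ hsign hu hv hfix)

/-! ### Twin blocks: the swap `B₁ ↔ B₂` of the last two blocks of size `N₂` -/

/-- The chart of the last two blocks of size `N₂`: `(j, false) ↦ m - 2N₂ + j ∈ B₁`, `(j, true) ↦ m - N₂ + j ∈ B₂`.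
[bookkeeping] -/
def twinChart (N₂ : ℕ) (h : 2 * N₂ ≤ m) : Fin N₂ × Bool ≃ {a : Fin m // m ≤ (a : ℕ) + 2 * N₂} where
  toFun jb := ⟨⟨if jb.2 then m - N₂ + (jb.1 : ℕ) else m - 2 * N₂ + (jb.1 : ℕ), by
      have := jb.1.2; split_ifs <;> omega⟩, by
      show m ≤ (if jb.2 then m - N₂ + (jb.1 : ℕ) else m - 2 * N₂ + (jb.1 : ℕ)) + 2 * N₂
      have := jb.1.2; split_ifs <;> omega⟩
  invFun a := (⟨if m ≤ (a : ℕ) + N₂ then (a : ℕ) + N₂ - m else (a : ℕ) + 2 * N₂ - m, by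
      have h₁ := a.1.2; have h₂ := a.2; split_ifs <;> omega⟩, decide (m ≤ (a : ℕ) + N₂))
  left_inv jb := by
    obtain ⟨j, b⟩ := jb
    have hj := j.2
    cases b
    · have e₁ : ¬ m ≤ (m - 2 * N₂ + (j : ℕ)) + N₂ := by omega
      simp only [if_neg e₁, Bool.false_eq_true, ↓reduceIte, decide_eq_false_iff_not, Prod.mk.injEq]
      exact ⟨Fin.ext (by simp only; omega), by simp [e₁]⟩
    · have e₁ : m ≤ (m - N₂ + (j : ℕ)) + N₂ := by omega
      simp only [↓reduceIte, Prod.mk.injEq]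
      exact ⟨Fin.ext (by simp only [if_pos e₁]; omega), by simp [e₁]⟩
  right_inv a := by
    have h₁ := a.1.2; have h₂ := a.2
    apply Subtype.ext; apply Fin.ext
    simp only [decide_eq_true_eq]
    split_ifs <;> omega

/-- The TWIN SWAP `σ = twinSwap N₂ h`: the involution of `Fin m` exchanging `B₁ = [m-2N₂, m-N₂)` with the last block
`B₂ = [m-N₂, m)` by `a ↦ a ± N₂` and fixing every other index (a product of `N₂` disjoint transpositions).
[bookkeeping] -/
def twinSwap (N₂ : ℕ) (h : 2 * N₂ ≤ m) : Equiv.Perm (Fin m) :=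
  Equiv.Perm.extendDomain (Equiv.prodCongrRight fun _ : Fin N₂ => Equiv.swap false true : Equiv.Perm (Fin N₂ × Bool))
    (twinChart N₂ h)

/-- `sign (twinSwap N₂) = (-1)^{N₂}`. [this node] -/
theorem sign_twinSwap (N₂ : ℕ) (h : 2 * N₂ ≤ m) : Equiv.Perm.sign (twinSwap N₂ h) = (-1 : ℤˣ) ^ N₂ := by
  unfold twinSwap
  rw [Equiv.Perm.sign_extendDomain, Equiv.Perm.sign_prodCongrRight]
  simp only [Equiv.Perm.sign_swap Bool.false_ne_true, Finset.prod_const, Finset.card_univ, Fintype.card_fin]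
  rfl

/-- The values of the twin swap. [bookkeeping] -/
theorem twinSwap_val {N₂ : ℕ} (h : 2 * N₂ ≤ m) (a : Fin m) : ((twinSwap N₂ h a : Fin m) : ℕ) =
    if m ≤ (a : ℕ) + N₂ then (a : ℕ) - N₂ else if m ≤ (a : ℕ) + 2 * N₂ then (a : ℕ) + N₂ else (a : ℕ) := by
  unfold twinSwap
  by_cases hA' : m ≤ (a : ℕ) + 2 * N₂
  · rw [Equiv.Perm.extendDomain_apply_subtype _ (twinChart N₂ h) hA']
    by_cases hA : m ≤ (a : ℕ) + N₂
    · simp only [twinChart, Equiv.coe_fn_symm_mk, Equiv.coe_fn_mk, Equiv.prodCongrRight_apply, if_pos hA,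
        decide_eq_true hA, Equiv.swap_apply_right, Bool.false_eq_true, ↓reduceIte, if_pos hA']
      omega
    · simp only [twinChart, Equiv.coe_fn_symm_mk, Equiv.coe_fn_mk, Equiv.prodCongrRight_apply, if_neg hA,
        decide_eq_false hA, Equiv.swap_apply_left, ↓reduceIte, if_pos hA']
      omega
  · rw [Equiv.Perm.extendDomain_apply_not_subtype _ (twinChart N₂ h) hA', if_neg (fun h' => hA' (by omega)), if_neg hA']

/-- The twin swap moves only indices of `B₁ ∪ B₂`; in particular it is a CORNER permutation for every format
`N ≥ 2N₂`. [bookkeeping] -/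
theorem le_of_twinSwap_ne {N₂ : ℕ} (h : 2 * N₂ ≤ m) {a : Fin m} (ha : twinSwap N₂ h a ≠ a) :
    m ≤ (a : ℕ) + 2 * N₂ := by
  by_contra hA'
  exact ha (Fin.ext (by rw [twinSwap_val, if_neg (fun h' => hA' (by omega)), if_neg hA']))

/-- `σ a ∈ B₂ ↔ a ∈ B₁`. [bookkeeping] -/
theorem twinSwap_mem_last_iff {N₂ : ℕ} (h : 2 * N₂ ≤ m) (a : Fin m) :
    m ≤ ((twinSwap N₂ h a : Fin m) : ℕ) + N₂ ↔ ¬ m ≤ (a : ℕ) + N₂ ∧ m ≤ (a : ℕ) + 2 * N₂ := by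
  have := a.2
  rw [twinSwap_val]
  split_ifs <;> omega

/-- `σ a ∈ B₁ ∪ B₂ ↔ a ∈ B₁ ∪ B₂`. [bookkeeping] -/
theorem twinSwap_mem_pair_iff {N₂ : ℕ} (h : 2 * N₂ ≤ m) (a : Fin m) :
    m ≤ ((twinSwap N₂ h a : Fin m) : ℕ) + 2 * N₂ ↔ m ≤ (a : ℕ) + 2 * N₂ := by
  have := a.2
  rw [twinSwap_val]
  split_ifs <;> omega

/-- The twin swap is an involution. [bookkeeping] -/
theorem twinSwap_twinSwap {N₂ : ℕ} (h : 2 * N₂ ≤ m) (a : Fin m) : twinSwap N₂ h (twinSwap N₂ h a) = a := by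
  apply Fin.ext
  have := a.2
  have h₁ := twinSwap_val h a
  rw [twinSwap_val h (twinSwap N₂ h a)]
  split_ifs at h₁ ⊢ <;> omega

variable (m) in
/-- TWIN-BLOCK-DIAGONAL tensors: a non-zero entry has its three indices all in `B₂`, all in `B₁`, or all outside
`B₁ ∪ B₂` (the shape `x ⊞ a ⊞ b`). [bookkeeping] -/
def twinDiag (N₂ : ℕ) : Set (Tensor ℂ m) :=
  {x | ∀ a b c : Fin m, x a b c ≠ 0 →
    (m ≤ (a : ℕ) + N₂ ∧ m ≤ (b : ℕ) + N₂ ∧ m ≤ (c : ℕ) + N₂) ∨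
      ((¬ m ≤ (a : ℕ) + N₂ ∧ m ≤ (a : ℕ) + 2 * N₂) ∧ (¬ m ≤ (b : ℕ) + N₂ ∧ m ≤ (b : ℕ) + 2 * N₂) ∧
        (¬ m ≤ (c : ℕ) + N₂ ∧ m ≤ (c : ℕ) + 2 * N₂)) ∨
      (¬ m ≤ (a : ℕ) + 2 * N₂ ∧ ¬ m ≤ (b : ℕ) + 2 * N₂ ∧ ¬ m ≤ (c : ℕ) + 2 * N₂)}

/-- Membership in `twinDiag`, unfolded. [bookkeeping] -/
theorem mem_twinDiag {N₂ : ℕ} {x : Tensor ℂ m} : x ∈ twinDiag m N₂ ↔ ∀ a b c : Fin m, x a b c ≠ 0 →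
    (m ≤ (a : ℕ) + N₂ ∧ m ≤ (b : ℕ) + N₂ ∧ m ≤ (c : ℕ) + N₂) ∨
      ((¬ m ≤ (a : ℕ) + N₂ ∧ m ≤ (a : ℕ) + 2 * N₂) ∧ (¬ m ≤ (b : ℕ) + N₂ ∧ m ≤ (b : ℕ) + 2 * N₂) ∧
        (¬ m ≤ (c : ℕ) + N₂ ∧ m ≤ (c : ℕ) + 2 * N₂)) ∨
      (¬ m ≤ (a : ℕ) + 2 * N₂ ∧ ¬ m ≤ (b : ℕ) + 2 * N₂ ∧ ¬ m ≤ (c : ℕ) + 2 * N₂) := Iff.rfl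

/-- A twin-block-diagonal tensor is block-diagonal for the last block. [bookkeeping] -/
theorem twinDiag_subset_blockDiag (N₂ : ℕ) : twinDiag m N₂ ⊆ blockDiag m N₂ := by
  intro x hx
  refine mem_blockDiag.2 fun a b c hne => ?_
  rcases hx a b c hne with h₁ | h₂ | h₃
  · exact Or.inl h₁
  · exact Or.inr ⟨h₂.1.1, h₂.2.1.1, h₂.2.2.1⟩
  · exact Or.inr ⟨fun h' => h₃.1 (by omega), fun h' => h₃.2.1 (by omega), fun h' => h₃.2.2 (by omega)⟩

/-- The twin swap of a twin-block-diagonal tensor is twin-block-diagonal. [bookkeeping] -/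
theorem actTensor_twinSwap_mem_twinDiag {N₂ : ℕ} (h : 2 * N₂ ≤ m) {u : Tensor ℂ m} (hu : u ∈ twinDiag m N₂) :
    actTensor ((twinSwap N₂ h).permMatrix ℂ) ((twinSwap N₂ h).permMatrix ℂ) ((twinSwap N₂ h).permMatrix ℂ) u ∈
      twinDiag m N₂ := by
  refine mem_twinDiag.2 fun a b c hne => ?_
  rw [actTensor_permMatrix_apply] at hne
  have key := hu _ _ _ hne
  simp only [twinSwap_mem_last_iff, twinSwap_mem_pair_iff] at key
  have ha := a.2; have hb := b.2; have hc := c.2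
  omega

/-- The HYBRID point `mixT N₂ u (σ·u)` (`= x ⊞ a ⊞ a` for `u = x ⊞ a ⊞ b`) is fixed by the twin swap. [bookkeeping] -/
theorem actTensor_twinSwap_mixT {N₂ : ℕ} (h : 2 * N₂ ≤ m) {u : Tensor ℂ m} (hu : u ∈ twinDiag m N₂) :
    actTensor ((twinSwap N₂ h).permMatrix ℂ) ((twinSwap N₂ h).permMatrix ℂ) ((twinSwap N₂ h).permMatrix ℂ)
        (mixT N₂ u (actTensor ((twinSwap N₂ h).permMatrix ℂ) ((twinSwap N₂ h).permMatrix ℂ)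
          ((twinSwap N₂ h).permMatrix ℂ) u)) =
      mixT N₂ u (actTensor ((twinSwap N₂ h).permMatrix ℂ) ((twinSwap N₂ h).permMatrix ℂ)
        ((twinSwap N₂ h).permMatrix ℂ) u) := by
  funext a b c
  simp only [actTensor_permMatrix_apply, mixT, twinSwap_twinSwap, twinSwap_mem_last_iff]
  have ha := a.2; have hb := b.2; have hc := c.2
  have hu₁ := hu a b c
  have hu₂ := hu (twinSwap N₂ h a) (twinSwap N₂ h b) (twinSwap N₂ h c)
  simp only [twinSwap_mem_last_iff, twinSwap_mem_pair_iff] at hu₂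
  by_cases hrest : ¬ m ≤ (a : ℕ) + 2 * N₂ ∧ ¬ m ≤ (b : ℕ) + 2 * N₂ ∧ ¬ m ≤ (c : ℕ) + 2 * N₂
  · have ea : twinSwap N₂ h a = a := by
      by_contra h'; exact hrest.1 (le_of_twinSwap_ne h h')
    have eb : twinSwap N₂ h b = b := by
      by_contra h'; exact hrest.2.1 (le_of_twinSwap_ne h h')
    have ec : twinSwap N₂ h c = c := by
      by_contra h'; exact hrest.2.2 (le_of_twinSwap_ne h h')
    rw [ea, eb, ec] at hu₂ ⊢
    split_ifs <;> rfl
  · split_ifs with h₁ h₂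
    · omega
    · rfl
    · rfl
    · have z₁ : u a b c = 0 := by
        by_contra hne; have := hu₁ hne; omega
      have z₂ : u (twinSwap N₂ h a) (twinSwap N₂ h b) (twinSwap N₂ h c) = 0 := by
        by_contra hne; have := hu₂ hne; omega
      rw [z₁, z₂]

/-- **(PP) for twin blocks.**  `f` a `((k^N))³`-weight vector of degree `kN`, `k` odd, `N₂` odd with `2N₂ ≤ N ≤ m`,
the block weight-vector space of type `((k^{N₂}))³`, degree `k N₂`, spanned by one `g`: then `f` vanishes at EVERY
twin-block-diagonal point `u = x ⊞ a ⊞ b` — symmetric or not. [this node] -/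
theorem evalT_eq_zero_of_twinBlocks {N N₂ k : ℕ} (h2 : 2 * N₂ ≤ N) (hNm : N ≤ m) (hk : Odd k) (hN₂ : Odd N₂)
    {f : MvPolynomial (Idx m) ℂ} (hf : f ∈ hwvSpace (rectType m N k) (k * N))
    {g : MvPolynomial (Idx m) ℂ} (hg : ∀ f' ∈ hwvSpace (rectType m N₂ k) (k * N₂), ∃ c : ℂ, f' = c • g)
    {u : Tensor ℂ m} (hu : u ∈ twinDiag m N₂) : evalT u f = 0 := by
  have h : 2 * N₂ ≤ m := h2.trans hNm
  refine evalT_eq_zero_of_propagatedParity (N₂ := N₂) (by omega) (by omega) hk hf hg (twinSwap N₂ h)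
    (fun a ha => (le_of_twinSwap_ne h ha).trans (by omega)) ?_ (twinDiag_subset_blockDiag N₂ hu)
    (twinDiag_subset_blockDiag N₂ (actTensor_twinSwap_mem_twinDiag h hu)) (actTensor_twinSwap_mixT h hu)
  rw [sign_twinSwap]
  exact hN₂.neg_one_pow

/-- Hence such an odd level `k` is not a level of any twin-block-diagonal point: `k ∉ E′_N(x ⊞ a ⊞ b)`. [this node] -/
theorem not_mem_pointLevels_of_twinBlocks {N N₂ k : ℕ} (h2 : 2 * N₂ ≤ N) (hNm : N ≤ m) (hk : Odd k)
    (hN₂ : Odd N₂) {g : MvPolynomial (Idx m) ℂ}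
    (hg : ∀ f' ∈ hwvSpace (rectType m N₂ k) (k * N₂), ∃ c : ℂ, f' = c • g)
    {u : Tensor ℂ m} (hu : u ∈ twinDiag m N₂) : k ∉ pointLevels N u := by
  rintro ⟨f, hf, hne⟩
  exact hne (evalT_eq_zero_of_twinBlocks h2 hNm hk hN₂ hf hg hu)

end PropagatedParity

end Summit.MatrixMultiplication.MatrixMultiplication.Theorems.ObstructionCalculus
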